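import Mathlib
import HarnessLib
import Summits.HubbardSuperconductivity.HubbardSuperconductivity.Theorems.KLProgrammeKLRegimeAlphaFatClosed

/-!
# Route `KLProgramme` — engine support, route (L2), FAT layer 5d: **`α_n` in CLOSED FORM, row and column sums** — `hrow`/`hcol` of the fat sector family at
# scale `m+1` for the slice with lower scale `Λ_{m+1}`: `≤ 8·9·4√(32·C_W·C_N)·(M/β)/Λ_{m+1}` (the per-pair bound of 5c × the overlap count 9)

Cell `gate-hubbard-kl`, seat hubbard-kl-k3c2-p3; gen-4 ENGINE child stmt-HubbardSuperconductivity-19855 (`stub_engine_step_norms`).  The engine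
instance of `rowSum_sliceCT_bgmFat_le`: `Λ = klScale e₀ (m+1)` (so `Λ_m = 4Λ`), tangent resolution `N_r = 2^{m+1}` (`N_r²Λ = e₀`,
`w_{m+1} = π/N_r`), canonical rates in closed form (`1/s₀ = x₀(M/β)/Λ`, `1/s₁ = x₁/Λ`, `s₂ = 2Λ/(π(N_r+½)√q_e)`, `s₃ = 2/(π(N_r+½)N_r√q_v)`),
the five rate hypotheses discharged by `…AlphaFatScalars`, and the product collapsed by `…AlphaFatScalars2`:

* **`rowSum_sliceCT_bgmFat_closed`** / **`colSum_sliceCT_bgmFat_closed`** — under `e₀ ≤ 1`, `β ≤ M`, `0 < K₁`, `π ≤ Λ_mβ`, `δ_L ≤ Λ²L`,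
  `L/(10N_r) ≤ R₀`, `2(2N_r+1)R₀ < L`, `2π·N_r(N_r+½) ≤ L`, `2|2π/L|(N_r+½) ≤ z`, `γπ ≤ 2√2·L·Λ` (`γ = 2ρ_min − 4A`):
  `Σ_{Y′}‖(S(Ft)ᵀ C S(Ft)) Y Y′‖ ≤ 288·√(32·C_W·C_N)·(M/β)/Λ`, with the abbreviation hypotheses `h…` (`:= rfl`) spelling `C_W, C_N` out.

n-UNIFORMITY: `C_W, C_N` depend on `(B, A, e₀, d, Ba, K₁, K₂, B₁, B₂, δ_L)` only; the thresholds are `L ≳ 4^{m+1}` and `Λ²L ≥ δ_L` (i.e.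
`L ≳ 16^{m+1}`, `≲ β²` at the last scale).  Everything is proved; no definitions. [folklore] (BGM 2006 §2.8 (2.81).)
-/

noncomputable section

namespace Summit.HubbardSuperconductivity.HubbardSuperconductivity.Theorems.TorusFourierL2

set_option linter.dupNamespace false -- summit = problem name (single-conjunct summit), D-0017

open Set Finset Literature.MathematicalPhysics.QuantumLattice Literature.MathematicalPhysics.QuantumLattice.BandSectorCounting
open Literature.MathematicalPhysics.QuantumLattice.FermiRG Literature.Probability.LatticeModels Literature.Analysis.SpecialFunctions
open Summit.HubbardSuperconductivity.HubbardSuperconductivity.Theorems.DispersionFlow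
open Summit.HubbardSuperconductivity.HubbardSuperconductivity.Theorems.KLRegimeSplit
open Summit.HubbardSuperconductivity.HubbardSuperconductivity.Theorems.KLProgrammeLegKernels
open Summit.HubbardSuperconductivity.HubbardSuperconductivity.Theorems.PerturbedFermiCurve
open scoped Real Nat

section Closed

open Classical

variable {L M : ℕ} [NeZero L] [NeZero M] {a b : ℝ} (B : BandBounds a b) {K : TrigPolyC4v} {A : ℝ}
  (hA : ∀ p : Momentum, ∀ j ≤ 2, ‖iteratedFDeriv ℝ j (frameShift K) p‖ ≤ A) (hADt : 2 * A < B.Dtmin)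
  {μ e₀ z β : ℝ} (he : 0 < e₀) (hz : 0 < z) (hz1 : z ≤ 1) (hgap : e₀ + A + z ^ 2 < -μ) (h3 : e₀ + A - μ ≤ 3)
  (hlo : a ≤ μ - A - e₀) (hhi : μ + A + e₀ ≤ b) (hβ : 0 < β) (hρA : 4 * A < 2 * B.rhomin)
  (m : ℕ) (hMm : klScale e₀ m * β < π * (2 * M - 3))
  {d : ℝ} (hd : 0 ≤ d) (hd1 : ∀ u, |deriv (bgmCutoffSq e₀) u| ≤ d) (hd2 : ∀ u, |iteratedDeriv 2 (bgmCutoffSq e₀) u| ≤ d)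
  {Ba : ℝ} (hB0 : 0 ≤ Ba)
  (hB : ∀ (i : ℕ), i ≤ 2 → ∀ (n : ℕ) (ω : ℤ) (θ₀ : ℝ) (q w : Fin 2 → ℝ) (t : ℝ) {r₀ : ℝ}, 0 < r₀ →
    r₀ ≤ ‖momToComplex (q + t • w)‖ → |sectorRelAngle θ₀ (q + t • w)| < π →
    ‖iteratedDeriv i (fun t : ℝ => sectorWeightCirc n ω (polarAngle (q + t • w))) t‖ ≤
      (2 : ℕ)! * Ba * ((1 + (sectorWidth n)⁻¹ * (2 : ℕ)!) * ‖momToComplex w‖ / r₀) ^ i)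
  {Λ' : ℝ} (hΛΛ' : klScale e₀ (m + 1) ≤ Λ') (hM' : Λ' < π * (2 * M - 3) / β)
  {K₁ K₂ : ℝ} (hK₁pos : 0 < K₁) (hK₁ : ∀ p, ‖fderiv ℝ (frameLevel μ K) p‖ ≤ K₁) (hK₂ : ∀ p, ‖iteratedFDeriv ℝ 2 (frameLevel μ K) p‖ ≤ K₂)
  {B₁ B₂ : ℝ} (hB₁ : ∀ x, |deriv salmhoferCutoff x| ≤ B₁) (hB₂ : ∀ x, |deriv (deriv salmhoferCutoff) x| ≤ B₂)
  -- regime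
  (he₁ : e₀ ≤ 1) (hβM : β ≤ (M : ℝ)) (hπβ : π ≤ klScale e₀ m * β)
  (hLz : 2 * |2 * π / L| * ((2 : ℝ) ^ (m + 1) + 1 / 2) ≤ z) (hLN : 2 * π * (2 : ℝ) ^ (m + 1) * ((2 : ℝ) ^ (m + 1) + 1 / 2) ≤ L)
  (hL1 : (2 * B.rhomin - 4 * A) * π ≤ 2 * Real.sqrt 2 * L * klScale e₀ (m + 1))
  {R₀ : ℕ} (hR₀ : 2 * (2 * (2 : ℝ) ^ (m + 1) + 1) * (R₀ : ℝ) < L) (hR₀' : (L : ℝ) / (10 * (2 : ℝ) ^ (m + 1)) ≤ R₀)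
  {δL : ℝ} (hδL : 0 < δL) (hΛL : δL ≤ klScale e₀ (m + 1) ^ 2 * L)
  -- the closed-form constants (instantiate with `rfl`)
  {cρ G₁ G₂ Kp b₁ bτ ae1 ae2 qe av1 av2 qv Dt x₀ x₁ x₂ x₃ c₁ CW CN : ℝ}
  (hcρ : cρ = (2 * e₀ / π + B.smax * B.Dtmin * (3 / 4)) / (B.Dtmin - 2 * A) + π * Real.sqrt 2 * (1 + (4 + 2 * A) / (B.Dtmin - 2 * A)))
  (hG₁ : G₁ = d * e₀ ^ 2 * 1 + 1 * (d * e₀ ^ 2)) (hG₂ : G₂ = d * e₀ ^ 4 * 1 + 2 * (d * e₀ ^ 2) * (d * e₀ ^ 2) + 1 * (d * e₀ ^ 4))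
  (hKp : Kp = 4 + 4 * A) (hb₁ : b₁ = 4 + 2 * A + Kp * (cρ * π + 2)) (hbτ : bτ = 4 + 2 * A + 2 * K₂ * (cρ * π))
  (hae1 : ae1 = G₁ * (4 + 2 * A + Kp * (cρ * π + 2)) / 2 + 72 * Ba * e₀)
  (hae2 : ae2 = (4 * G₂ + 2 * G₁) * (4 + 2 * A + Kp * (cρ * π + 2)) ^ 2 / 16 + G₁ * Kp * e₀ / 2 +
    144 * G₁ * (4 + 2 * A + Kp * (cρ * π + 2)) * Ba * e₀ + 36 * (4 * Ba + 8 * Ba ^ 2) * e₀ ^ 2)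
  (hqe : qe = (32 * B₂ + 144 * B₁ + 128) * (Real.sqrt 2 * K₁ + 8 * K₂) ^ 2 / 4 + (16 * B₁ + 16) * K₂ * e₀ / 2 +
    ae1 * (16 * B₁ + 16) * (Real.sqrt 2 * K₁ + 6 * K₂) / 2 + ae2)
  (hav1 : av1 = G₁ * (4 + 2 * A + Kp * (cρ * π + 2)) / (2 * e₀) + 288 * Ba)
  (hav2 : av2 = (4 * G₂ + 2 * G₁) * (4 + 2 * A + Kp * (cρ * π + 2)) ^ 2 / (16 * e₀ ^ 2) + G₁ * Kp / (2 * e₀) +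
    144 * G₁ * (4 + 2 * A + Kp * (cρ * π + 2)) * Ba / e₀ + 144 * (4 * Ba + 8 * Ba ^ 2))
  (hqv : qv = (32 * B₂ + 144 * B₁ + 128) * (bτ + 8 * K₂) ^ 2 / (4 * e₀ ^ 2) + (16 * B₁ + 16) * K₂ / (2 * e₀) +
    av1 * (16 * B₁ + 16) * (bτ + 6 * K₂) / (2 * e₀) + av2)
  (hDt : Dt = (32 * B₂ + 144 * B₁ + 128) + G₁ * (16 * B₁ + 16) + G₂ + G₁ / 2)
  (hx₀ : x₀ = π / 2 * Real.sqrt Dt) (hx₁ : x₁ = π / 2 * Real.sqrt qe) (hx₂ : x₂ = 5 * π / 4 * Real.sqrt qe) (hx₃ : x₃ = 5 * π / 4 * Real.sqrt qv)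
  (hc₁ : c₁ = 4 + Kp * cρ ^ 2 * π ^ 2 / e₀)
  (hCW : CW = 4096 * x₀ * (4 * ((2 * Real.sqrt 2 * x₂ + 2) * (2 * Real.sqrt 2 * x₃ + 1)) + 160 * x₁ * (x₁ + 1) ^ 2 / δL))
  (hCN : CN = 128 * c₁ * cρ / (π ^ 2 * (2 * B.rhomin - 4 * A)))

include B hA hADt he hz hz1 hgap h3 hlo hhi hβ hρA hMm hd hd1 hd2 hB0 hB hΛΛ' hM' hK₁pos hK₁ hK₂ hB₁ hB₂ he₁ hβM hπβ hLz hLN hL1 hR₀ hR₀' hδL hΛL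
  hcρ hG₁ hG₂ hKp hb₁ hbτ hae1 hae2 hqe hav1 hav2 hqv hDt hx₀ hx₁ hx₂ hx₃ hc₁ hCW hCN

/-- **`hrow` in closed form.** [cite: BenfattoGiulianiMastropietro2006, §2.8 (2.81)] -/
theorem rowSum_sliceCT_bgmFat_closed (Y : SpaceTimeIdx L M × SectorLeg (sectorCount (m + 1))) :
    ∑ Y' : SpaceTimeIdx L M × SectorLeg (sectorCount (m + 1)),
        ‖((sectorSubMatrix L M β (bgmFatMultiplier L M e₀ β (nambuXiCT L μ K) (m + 1))).transpose *
            hubbardCovSliceCT L M β μ 0 K (klScale e₀ (m + 1)) Λ' *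
              sectorSubMatrix L M β (bgmFatMultiplier L M e₀ β (nambuXiCT L μ K) (m + 1))) Y Y'‖ ≤
      8 * ((9 : ℕ) * (4 * Real.sqrt (32 * CW * CN) * ((M : ℝ) / β) / klScale e₀ (m + 1))) := by
  have hT0 := slicePair_bgmFat_closed B hA hADt he hz hz1 hgap h3 hlo hhi hβ hρA m hMm hd hd1 hd2 hB0 hB hΛΛ' hM' hK₁pos hK₁ hK₂ hB₁ hB₂
      he₁ hβM hπβ hLz hLN hL1 hR₀ hR₀' hδL hΛL hcρ hG₁ hG₂ hKp hb₁ hbτ hae1 hae2 hqe hav1 hav2 hqv hDt hx₀ hx₁ hx₂ hx₃ hc₁ hCW hCN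
      ⟨0, sectorCount_pos _⟩ ⟨0, sectorCount_pos _⟩
  have hTmax : 0 ≤ 4 * Real.sqrt (32 * CW * CN) * ((M : ℝ) / β) / klScale e₀ (m + 1) :=
    le_trans (Finset.sum_nonneg fun _ _ => norm_nonneg _) hT0
  refine rowSum_norm_pullback_sliceCT_le_alpha hβ.ne' μ K (klScale e₀ (m + 1)) Λ' _
    (fun ω ω' => ∃ k : FreqMomentum L M, bgmFatMultiplier L M e₀ β (nambuXiCT L μ K) (m + 1) ω k *
      bgmFatMultiplier L M e₀ β (nambuXiCT L μ K) (m + 1) ω' k ≠ 0) hTmax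
    (fun ω ω' _ => slicePair_bgmFat_closed B hA hADt he hz hz1 hgap h3 hlo hhi hβ hρA m hMm hd hd1 hd2 hB0 hB hΛΛ' hM' hK₁pos hK₁ hK₂ hB₁ hB₂
      he₁ hβM hπβ hLz hLN hL1 hR₀ hR₀' hδL hΛL hcρ hG₁ hG₂ hKp hb₁ hbτ hae1 hae2 hqe hav1 hav2 hqv hDt hx₀ hx₁ hx₂ hx₃ hc₁ hCW hCN ω ω')
    (fun ω ω' h k => ?_) (fun ω => card_overlap_bgmFat_le_nine (L := L) (M := M) (K := K) (μ := μ) (e₀ := e₀) (β := β) m ω) Y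
  by_contra hk
  exact h ⟨k, hk⟩

/-- **`hcol` in closed form.** [cite: BenfattoGiulianiMastropietro2006, §2.8 (2.81)] -/
theorem colSum_sliceCT_bgmFat_closed (Y' : SpaceTimeIdx L M × SectorLeg (sectorCount (m + 1))) :
    ∑ Y : SpaceTimeIdx L M × SectorLeg (sectorCount (m + 1)),
        ‖((sectorSubMatrix L M β (bgmFatMultiplier L M e₀ β (nambuXiCT L μ K) (m + 1))).transpose *
            hubbardCovSliceCT L M β μ 0 K (klScale e₀ (m + 1)) Λ' *
              sectorSubMatrix L M β (bgmFatMultiplier L M e₀ β (nambuXiCT L μ K) (m + 1))) Y Y'‖ ≤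
      8 * ((9 : ℕ) * (4 * Real.sqrt (32 * CW * CN) * ((M : ℝ) / β) / klScale e₀ (m + 1))) := by
  have hT0 := slicePair_bgmFat_closed B hA hADt he hz hz1 hgap h3 hlo hhi hβ hρA m hMm hd hd1 hd2 hB0 hB hΛΛ' hM' hK₁pos hK₁ hK₂ hB₁ hB₂
      he₁ hβM hπβ hLz hLN hL1 hR₀ hR₀' hδL hΛL hcρ hG₁ hG₂ hKp hb₁ hbτ hae1 hae2 hqe hav1 hav2 hqv hDt hx₀ hx₁ hx₂ hx₃ hc₁ hCW hCN
      ⟨0, sectorCount_pos _⟩ ⟨0, sectorCount_pos _⟩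
  have hTmax : 0 ≤ 4 * Real.sqrt (32 * CW * CN) * ((M : ℝ) / β) / klScale e₀ (m + 1) :=
    le_trans (Finset.sum_nonneg fun _ _ => norm_nonneg _) hT0
  refine colSum_norm_pullback_sliceCT_le_alpha hβ.ne' μ K (klScale e₀ (m + 1)) Λ' _
    (fun ω ω' => ∃ k : FreqMomentum L M, bgmFatMultiplier L M e₀ β (nambuXiCT L μ K) (m + 1) ω k *
      bgmFatMultiplier L M e₀ β (nambuXiCT L μ K) (m + 1) ω' k ≠ 0) hTmax
    (fun ω ω' _ => slicePair_bgmFat_closed B hA hADt he hz hz1 hgap h3 hlo hhi hβ hρA m hMm hd hd1 hd2 hB0 hB hΛΛ' hM' hK₁pos hK₁ hK₂ hB₁ hB₂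
      he₁ hβM hπβ hLz hLN hL1 hR₀ hR₀' hδL hΛL hcρ hG₁ hG₂ hKp hb₁ hbτ hae1 hae2 hqe hav1 hav2 hqv hDt hx₀ hx₁ hx₂ hx₃ hc₁ hCW hCN ω ω')
    (fun ω ω' h k => ?_) (fun ω' => card_overlap_bgmFat_le_nine' (L := L) (M := M) (K := K) (μ := μ) (e₀ := e₀) (β := β) m ω') Y'
  by_contra hk
  exact h ⟨k, hk⟩

end Closed

end Summit.HubbardSuperconductivity.HubbardSuperconductivity.Theorems.TorusFourierL2

end
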